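import Literature.Analysis.FunctionSpaces.TorusFourierSynthesis
import Literature.Analysis.FunctionSpaces.TorusSobolevNormFacts
import HarnessLib

/-!
# Smooth Fourier multipliers on the flat torus

Analysis/FunctionSpaces support file. With the synthesis dictionary of `TorusFourierSynthesis`
(`RapidDecay c ↦ fourierSynth c ∈ C^∞`, `𝓕 ∘ fourierSynth = id`, `fourierSynth ∘ 𝓕 = id` on
smooth functions), a family of continuous linear maps `m k : V →L[ℂ] W` of polynomial growth in
`k ∈ ℤ^d` defines the **Fourier multiplier** `T_m f = ∑_k e_k • m k (𝓕f(k))` on smooth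
`V`-valued functions (the elementary `C^∞` version of the classical notion; cf. Grafakos 2014,
§4.3 for multipliers on `L^p(𝐓ⁿ)`): `T_m f` is smooth with `𝓕(T_m f) = m · 𝓕f`, multipliers
compose by composing symbols, and the constant-coefficient differential operators are
multipliers (`∂ⱼ ↔ 2πi kⱼ`, `Δ ↔ -4π²|k|²`; Grafakos 2014, Prop. 3.1.2 (10)), so that linear
constant-coefficient identities between such operators reduce to identities between symbols.
Concrete operators of this kind already in the tree are built differently and are deliberately
not redefined here: `Torus.invLaplacian` (`TorusInverseLaplacian`, by a continuous kernel), the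
antidivergence `Torus.antidivergence` (`FluidPDE/Antidivergence`), `BDSV.biotSavart`
(`FluidPDE/OnsagerBDSVGluing`).

## Contents (all proved)

* `Torus.HasPolyGrowth m` (with `add`, `comp`, constant and scalar symbols) and
  `RapidDecay.transfer` (domination across codomains); `Torus.multiplier m f`; for smooth `f`:
  smoothness (`IsSmooth.multiplier`), coefficients (`IsSmooth.mFourierCoeff_multiplier`),
  composition (`IsSmooth.multiplier_multiplier`), the identity symbol, constant symbols
  (`IsSmooth.multiplier_const`), additivity in the symbol and in the function, complex scalars.
* `IsSmooth.partialDeriv_eq_multiplier`, `IsSmooth.laplacian_eq_multiplier`.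

## References

* L. Grafakos, *Classical Fourier Analysis*, 3rd ed., GTM 249 (2014), Prop. 3.1.2 (10)
  (PDF p. 188).
-/

noncomputable section

open Set Filter Function MeasureTheory UnitAddTorus Complex
open scoped Topology ContDiff BigOperators

namespace Literature.Analysis.FunctionSpaces

namespace Torus

variable {d : Type*} [Fintype d] [DecidableEq d]
variable {V W X : Type*} [NormedAddCommGroup V] [NormedSpace ℂ V] [CompleteSpace V]
  [NormedAddCommGroup W] [NormedSpace ℂ W] [CompleteSpace W]
  [NormedAddCommGroup X] [NormedSpace ℂ X] [CompleteSpace X]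

/-! ## Symbols of polynomial growth and the multiplier operators -/

section Multiplier

/-- A symbol `m : ℤ^d → (V →L[ℂ] W)` has **polynomial growth** if `‖m k‖ ≤ C (1 + |k|²)^s`.
[folklore] -/
def HasPolyGrowth (m : (d → ℤ) → V →L[ℂ] W) : Prop :=
  ∃ (C : ℝ) (s : ℕ), ∀ k, ‖m k‖ ≤ C * (1 + freqNormSq k) ^ s

/-- The **Fourier multiplier** with symbol `m`: `T_m f = ∑_k e_k • m k (𝓕f(k))` (the `C^∞`
version of the classical notion; cf. Grafakos 2014, §4.3 for `L^p`). [folklore] -/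
def multiplier (m : (d → ℤ) → V →L[ℂ] W) (f : UnitAddTorus d → V) : UnitAddTorus d → W :=
  fourierSynth fun k => m k (mFourierCoeff f k)

variable {m m' : (d → ℤ) → V →L[ℂ] W} {n : (d → ℤ) → W →L[ℂ] X} {f g : UnitAddTorus d → V}

omit [DecidableEq d] [NormedSpace ℂ V] [CompleteSpace V] [NormedSpace ℂ W] [CompleteSpace W] in
/-- Domination across codomains: if `‖c' k‖ ≤ C (1 + |k|²)^s ‖c k‖` with `c` rapidly decaying
(`V`-valued) then `c'` (`W`-valued) decays rapidly (`RapidDecay.of_norm_le_mul_pow` is the case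
`W = V`). [folklore] -/
theorem RapidDecay.transfer {c : (d → ℤ) → V} {c' : (d → ℤ) → W} (hc : RapidDecay c) {C : ℝ}
    {s : ℕ} (h : ∀ k, ‖c' k‖ ≤ C * (1 + freqNormSq k) ^ s * ‖c k‖) : RapidDecay c' := by
  intro m
  have hC : ∀ k, 0 ≤ C * (1 + freqNormSq k) ^ s * ‖c k‖ := fun k => (norm_nonneg _).trans (h k)
  refine Summable.of_nonneg_of_le
    (fun k => mul_nonneg (one_add_freqNormSq_pow_nonneg k m) (norm_nonneg _))
    (fun k => mul_le_mul_of_nonneg_left (h k) (one_add_freqNormSq_pow_nonneg k m)) ?_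
  have := (hc (m + s)).mul_left |C|
  refine Summable.of_nonneg_of_le
    (fun k => mul_nonneg (one_add_freqNormSq_pow_nonneg k m) (hC k)) (fun k => ?_) this
  calc (1 + freqNormSq k) ^ m * (C * (1 + freqNormSq k) ^ s * ‖c k‖)
      = C * ((1 + freqNormSq k) ^ (m + s) * ‖c k‖) := by rw [pow_add]; ring
    _ ≤ |C| * ((1 + freqNormSq k) ^ (m + s) * ‖c k‖) :=
        mul_le_mul_of_nonneg_right (le_abs_self C)
          (mul_nonneg (one_add_freqNormSq_pow_nonneg k _) (norm_nonneg _))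

omit [DecidableEq d] [CompleteSpace V] [CompleteSpace W] in
/-- Symbols of polynomial growth map rapidly decaying families to rapidly decaying families.
[folklore] -/
theorem HasPolyGrowth.rapidDecay (hm : HasPolyGrowth m) {c : (d → ℤ) → V} (hc : RapidDecay c) :
    RapidDecay fun k => m k (c k) := by
  obtain ⟨C, s, hC⟩ := hm
  have hb : ∀ k, ‖m k (c k)‖ ≤ C * (1 + freqNormSq k) ^ s * ‖c k‖ := fun k =>
    calc ‖m k (c k)‖ ≤ ‖m k‖ * ‖c k‖ := ContinuousLinearMap.le_opNorm (m k) (c k)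
      _ ≤ C * (1 + freqNormSq k) ^ s * ‖c k‖ := mul_le_mul_of_nonneg_right (hC k) (norm_nonneg _)
  exact hc.transfer hb

omit [DecidableEq d] [CompleteSpace V] [CompleteSpace W] in
/-- Constant symbols have polynomial growth. [folklore] -/
theorem hasPolyGrowth_const (L : V →L[ℂ] W) : HasPolyGrowth (fun _ : d → ℤ => L) :=
  ⟨‖L‖, 0, fun k => by simp⟩

omit [DecidableEq d] [CompleteSpace V] [CompleteSpace W] in
/-- Sums of symbols of polynomial growth have polynomial growth. [folklore] -/
theorem HasPolyGrowth.add (hm : HasPolyGrowth m) (hm' : HasPolyGrowth m') :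
    HasPolyGrowth (m + m') := by
  obtain ⟨C, s, hC⟩ := hm
  obtain ⟨C', s', hC'⟩ := hm'
  refine ⟨|C| + |C'|, s + s', fun k => ?_⟩
  have hw := one_le_one_add_freqNormSq k
  have h1 : (1 + freqNormSq k) ^ s ≤ (1 + freqNormSq k) ^ (s + s') :=
    pow_le_pow_right₀ hw (Nat.le_add_right s s')
  have h2 : (1 + freqNormSq k) ^ s' ≤ (1 + freqNormSq k) ^ (s + s') :=
    pow_le_pow_right₀ hw (Nat.le_add_left s' s)
  calc ‖(m + m') k‖ ≤ ‖m k‖ + ‖m' k‖ := norm_add_le _ _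
    _ ≤ C * (1 + freqNormSq k) ^ s + C' * (1 + freqNormSq k) ^ s' := add_le_add (hC k) (hC' k)
    _ ≤ |C| * (1 + freqNormSq k) ^ (s + s') + |C'| * (1 + freqNormSq k) ^ (s + s') :=
        add_le_add
          ((mul_le_mul_of_nonneg_right (le_abs_self C) (one_add_freqNormSq_pow_nonneg k s)).trans
            (mul_le_mul_of_nonneg_left h1 (abs_nonneg C)))
          ((mul_le_mul_of_nonneg_right (le_abs_self C') (one_add_freqNormSq_pow_nonneg k s')).trans
            (mul_le_mul_of_nonneg_left h2 (abs_nonneg C')))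
    _ = (|C| + |C'|) * (1 + freqNormSq k) ^ (s + s') := by ring

omit [DecidableEq d] [CompleteSpace V] [CompleteSpace W] in
/-- Scalar symbols `k ↦ a k • L` with `|a k| ≤ C (1 + |k|²)^s` have polynomial growth. [folklore] -/
theorem hasPolyGrowth_smul {a : (d → ℤ) → ℂ} {C : ℝ} {s : ℕ}
    (ha : ∀ k, ‖a k‖ ≤ C * (1 + freqNormSq k) ^ s) (L : V →L[ℂ] W) :
    HasPolyGrowth fun k => a k • L :=
  ⟨C * ‖L‖, s, fun k => by
    rw [norm_smul]
    calc ‖a k‖ * ‖L‖ ≤ C * (1 + freqNormSq k) ^ s * ‖L‖ :=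
          mul_le_mul_of_nonneg_right (ha k) (norm_nonneg _)
      _ = C * ‖L‖ * (1 + freqNormSq k) ^ s := by ring⟩

omit [DecidableEq d] [CompleteSpace V] [CompleteSpace W] [CompleteSpace X] in
/-- Compositions of symbols of polynomial growth have polynomial growth. [folklore] -/
theorem HasPolyGrowth.comp (hn : HasPolyGrowth n) (hm : HasPolyGrowth m) :
    HasPolyGrowth fun k => (n k).comp (m k) := by
  obtain ⟨C, s, hC⟩ := hn
  obtain ⟨C', s', hC'⟩ := hm
  refine ⟨|C| * |C'|, s + s', fun k => ?_⟩
  have h0 : 0 ≤ (1 + freqNormSq k) ^ s := one_add_freqNormSq_pow_nonneg k s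
  have h0' : 0 ≤ (1 + freqNormSq k) ^ s' := one_add_freqNormSq_pow_nonneg k s'
  calc ‖(n k).comp (m k)‖ ≤ ‖n k‖ * ‖m k‖ := ContinuousLinearMap.opNorm_comp_le _ _
    _ ≤ (C * (1 + freqNormSq k) ^ s) * (C' * (1 + freqNormSq k) ^ s') :=
        mul_le_mul (hC k) (hC' k) (norm_nonneg _) ((norm_nonneg _).trans (hC k))
    _ ≤ (|C| * (1 + freqNormSq k) ^ s) * (|C'| * (1 + freqNormSq k) ^ s') :=
        mul_le_mul (mul_le_mul_of_nonneg_right (le_abs_self C) h0)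
          (mul_le_mul_of_nonneg_right (le_abs_self C') h0')
          ((norm_nonneg _).trans (hC' k)) (mul_nonneg (abs_nonneg C) h0)
    _ = |C| * |C'| * (1 + freqNormSq k) ^ (s + s') := by rw [pow_add]; ring

/-- **Multipliers of smooth functions are smooth.** [folklore] -/
theorem IsSmooth.multiplier (hf : IsSmooth f) (hm : HasPolyGrowth m) :
    IsSmooth (Torus.multiplier m f) :=
  (hm.rapidDecay hf.rapidDecay_mFourierCoeff).isSmooth_fourierSynth

/-- **The coefficients of a multiplier**: `𝓕(T_m f)(k) = m k (𝓕f(k))`. [folklore] -/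
theorem IsSmooth.mFourierCoeff_multiplier (hf : IsSmooth f) (hm : HasPolyGrowth m) (k : d → ℤ) :
    mFourierCoeff (Torus.multiplier m f) k = m k (mFourierCoeff f k) :=
  (hm.rapidDecay hf.rapidDecay_mFourierCoeff).mFourierCoeff_fourierSynth k

/-- **Composition of multipliers = product of symbols** on smooth functions:
`T_n (T_m f) = T_{n ∘ m} f`. [folklore] -/
theorem IsSmooth.multiplier_multiplier (hf : IsSmooth f) (hm : HasPolyGrowth m)
    (hn : HasPolyGrowth n) :
    Torus.multiplier n (Torus.multiplier m f) = Torus.multiplier (fun k => (n k).comp (m k)) f := by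
  refine ((hf.multiplier hm).multiplier hn).ext_mFourierCoeff (hf.multiplier (hn.comp hm))
    fun k => ?_
  rw [(hf.multiplier hm).mFourierCoeff_multiplier hn, hf.mFourierCoeff_multiplier hm,
    hf.mFourierCoeff_multiplier (hn.comp hm), ContinuousLinearMap.comp_apply]

/-- The multiplier with the identity symbol is the identity on smooth functions (Fourier
inversion). [folklore] -/
theorem IsSmooth.multiplier_id (hf : IsSmooth f) :
    Torus.multiplier (fun _ : d → ℤ => ContinuousLinearMap.id ℂ V) f = f := by
  simpa [Torus.multiplier] using hf.fourierSynth_mFourierCoeff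

/-- **Constant symbols act pointwise**: `T_{k ↦ L} f = L ∘ f` for smooth `f`. [folklore] -/
theorem IsSmooth.multiplier_const (hf : IsSmooth f) (L : V →L[ℂ] W) :
    Torus.multiplier (fun _ : d → ℤ => L) f = fun x => L (f x) := by
  have hLf : IsSmooth fun x => L (f x) := hf.comp_clm (L.restrictScalars ℝ)
  refine (hf.multiplier (hasPolyGrowth_const L)).ext_mFourierCoeff hLf fun k => ?_
  rw [hf.mFourierCoeff_multiplier (hasPolyGrowth_const L), mFourierCoeff_eq_integral_volume,
    mFourierCoeff_eq_integral_volume,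
    ← ContinuousLinearMap.integral_comp_comm L (integrable_mFourier_smul' hf.integrable k)]
  congr 1
  funext x
  rw [map_smul]

omit [DecidableEq d] [CompleteSpace V] [CompleteSpace W] in
/-- Two multipliers whose symbols agree on the coefficients of `f` agree on `f`. [folklore] -/
theorem multiplier_congr (h : ∀ k, m k (mFourierCoeff f k) = m' k (mFourierCoeff f k)) :
    Torus.multiplier m f = Torus.multiplier m' f := by
  unfold Torus.multiplier
  congr 1
  funext k
  exact h k

/-- Multipliers are additive in the symbol (on smooth functions). [folklore] -/
theorem IsSmooth.multiplier_add_symbol (hf : IsSmooth f) (hm : HasPolyGrowth m)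
    (hm' : HasPolyGrowth m') :
    Torus.multiplier (m + m') f = fun x => Torus.multiplier m f x + Torus.multiplier m' f x := by
  refine (hf.multiplier (hm.add hm')).ext_mFourierCoeff
    ((hf.multiplier hm).add (hf.multiplier hm')) fun k => ?_
  rw [hf.mFourierCoeff_multiplier (hm.add hm'),
    show (fun x => Torus.multiplier m f x + Torus.multiplier m' f x) =
      Torus.multiplier m f + Torus.multiplier m' f from rfl,
    mFourierCoeff_add (hf.multiplier hm).integrable (hf.multiplier hm').integrable,
    hf.mFourierCoeff_multiplier hm, hf.mFourierCoeff_multiplier hm']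
  rfl

/-- Multipliers are additive in the function (on smooth functions). [folklore] -/
theorem IsSmooth.multiplier_add (hf : IsSmooth f) (hg : IsSmooth g) (hm : HasPolyGrowth m) :
    Torus.multiplier m (fun x => f x + g x) =
      fun x => Torus.multiplier m f x + Torus.multiplier m g x := by
  have hfg : IsSmooth fun x => f x + g x := hf.add hg
  refine (hfg.multiplier hm).ext_mFourierCoeff ((hf.multiplier hm).add (hg.multiplier hm))
    fun k => ?_
  rw [hfg.mFourierCoeff_multiplier hm, show (fun x => f x + g x) = f + g from rfl,
    mFourierCoeff_add hf.integrable hg.integrable, map_add,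
    show (fun x => Torus.multiplier m f x + Torus.multiplier m g x) =
      Torus.multiplier m f + Torus.multiplier m g from rfl,
    mFourierCoeff_add (hf.multiplier hm).integrable (hg.multiplier hm).integrable,
    hf.mFourierCoeff_multiplier hm, hg.mFourierCoeff_multiplier hm]

/-- Multipliers commute with complex scalars (on smooth functions). [folklore] -/
theorem IsSmooth.multiplier_const_smul (hf : IsSmooth f) (hm : HasPolyGrowth m) (a : ℂ) :
    Torus.multiplier m (fun x => a • f x) = fun x => a • Torus.multiplier m f x := by
  have haf : IsSmooth fun x => a • f x := ContDiff.const_smul a hf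
  have hamf : IsSmooth fun x => a • Torus.multiplier m f x := ContDiff.const_smul a (hf.multiplier hm)
  refine (haf.multiplier hm).ext_mFourierCoeff hamf fun k => ?_
  have h1 : mFourierCoeff (fun x => a • f x) k = a • mFourierCoeff f k := by
    rw [mFourierCoeff_eq_integral_volume, mFourierCoeff_eq_integral_volume, ← integral_smul]
    congr 1
    funext x
    rw [smul_comm]
  have h2 : mFourierCoeff (fun x => a • Torus.multiplier m f x) k =
      a • mFourierCoeff (Torus.multiplier m f) k := by
    rw [mFourierCoeff_eq_integral_volume, mFourierCoeff_eq_integral_volume, ← integral_smul]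
    congr 1
    funext x
    rw [smul_comm]
  rw [haf.mFourierCoeff_multiplier hm, h1, map_smul, h2, hf.mFourierCoeff_multiplier hm]

end Multiplier

/-! ## Differential operators as multipliers -/

section Differential

variable {f : UnitAddTorus d → V}

omit [DecidableEq d] [CompleteSpace V] in
/-- The symbol of `∂ⱼ`, `k ↦ (2πi kⱼ) • id`, has polynomial growth. [folklore] -/
theorem hasPolyGrowth_partialDeriv (j : d) :
    HasPolyGrowth fun k : d → ℤ => (2 * Real.pi * Complex.I * (k j)) • ContinuousLinearMap.id ℂ V := by
  refine hasPolyGrowth_smul (C := 2 * Real.pi) (s := 1) (fun k => ?_) _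
  have hn : ‖(2 * Real.pi * Complex.I * (k j) : ℂ)‖ = 2 * Real.pi * |(k j : ℝ)| := by
    simp [abs_of_pos Real.pi_pos]
  rw [hn, pow_one]
  exact mul_le_mul_of_nonneg_left (abs_apply_le_one_add_freqNormSq k j) (by positivity)

/-- **`∂ⱼ` is the multiplier `2πi kⱼ`** on smooth functions (Grafakos 2014, Prop. 3.1.2 (10)).
[cite: Grafakos2014, Prop. 3.1.2 (10)] -/
theorem IsSmooth.partialDeriv_eq_multiplier (hf : IsSmooth f) (j : d) :
    Torus.partialDeriv j f =
      Torus.multiplier (fun k : d → ℤ => (2 * Real.pi * Complex.I * (k j)) • ContinuousLinearMap.id ℂ V) f := by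
  conv_lhs => rw [← hf.fourierSynth_mFourierCoeff]
  rw [hf.rapidDecay_mFourierCoeff.partialDeriv_fourierSynth_eq j]
  rfl

omit [DecidableEq d] [CompleteSpace V] in
/-- The symbol of `Δ`, `k ↦ -(4π²|k|²) • id`, has polynomial growth. [folklore] -/
theorem hasPolyGrowth_laplacian :
    HasPolyGrowth fun k : d → ℤ =>
      (-(4 * Real.pi ^ 2 * freqNormSq k : ℝ) : ℂ) • ContinuousLinearMap.id ℂ V := by
  refine hasPolyGrowth_smul (C := 4 * Real.pi ^ 2) (s := 1) (fun k => ?_) _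
  rw [norm_neg, Complex.norm_real, Real.norm_eq_abs, abs_of_nonneg (by
    have := freqNormSq_nonneg k; positivity), pow_one]
  have := freqNormSq_nonneg k
  nlinarith [Real.pi_pos, sq_nonneg Real.pi]

/-- **`Δ` is the multiplier `-4π²|k|²`** on smooth functions. [cite: Grafakos2014, Prop. 3.1.2 (10)] -/
theorem IsSmooth.laplacian_eq_multiplier (hf : IsSmooth f) :
    Torus.laplacian f = Torus.multiplier (fun k : d → ℤ =>
      (-(4 * Real.pi ^ 2 * freqNormSq k : ℝ) : ℂ) • ContinuousLinearMap.id ℂ V) f := by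
  refine hf.laplacian.ext_mFourierCoeff (hf.multiplier hasPolyGrowth_laplacian) fun k => ?_
  rw [mFourierCoeff_laplacian hf, hf.mFourierCoeff_multiplier hasPolyGrowth_laplacian,
    _root_.smul_apply, ContinuousLinearMap.id_apply, neg_smul]

end Differential

end Torus

end Literature.Analysis.FunctionSpaces
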